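import Mathlib
import HarnessLib

/-!
# Route `IntegerScrew` — the state functions ROOM `ρ_x`, `∏_{p∣x}(1 − e^{−uθ_p})` and `W(x) = ∏_{p∣x} p/(p−1)`
# under the five move types of the walk (CONTINUUM-LIMIT 16.2 / 16.4 «DERIVATION»)

The comparison functions of THEOREM C♯ (CONTINUUM-LIMIT 16.2) are products of LEMMA G's `K(u,ρ_x)` with two
functions of the SET of prime divisors of the state `x`: `Π(u;x) = ∏_{p∣x}(1 − e^{−uθ_p})` (`θ_p = log p/L`) and
`W(x) = ∏_{p∣x} p/(p−1)`, and of the room `ρ_x = 1 − log x/L` through `K`.  The exact decomposition 16.4 rests on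
how these three change under the walk's five move types — birth of a NEW prime `q ∤ x` (`x → xq^a`), birth of a
power of a PRESENT prime (`x → xp^a`, `p ∣ x`), PARTIAL death (`x → x/p^b`, `b < v_p(x)`), FULL death
(`x → x/p^{v_p(x)}`): the room shifts by `∓a·θ`, the prime set gains `q` / is unchanged / is unchanged / loses `p`.
This file proves exactly those bookkeeping rules (`room_mul`, `room_div`, `primeFactors_mul_prime_pow_of_not_dvd`,
`primeFactors_mul_pow_of_dvd`, `primeFactors_div_pow_of_lt`, `primeFactors_ordCompl`, and the resulting product
rules for `primeProd` and `wProd`).  Elementary (`Nat.primeFactors`, `Real.log`); RH-free.  Nothing here bears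
on the truth of RH.  References: CONTINUUM-LIMIT §16.2, §16.4 (rh-explicit, A6-PIVOT theory); M. Suzuki, J. Lond.
Math. Soc. (2) 108 (2023) 1448–1487 [Suzuki2023].
-/

noncomputable section

-- D-0017: `Summit.<S>.<S>.…` is the designed namespace of a single-problem summit.
set_option linter.dupNamespace false

namespace Summit.RiemannHypothesis.RiemannHypothesis.Theorems.IntegerScrew

open Finset

/-! ## Definitions -/

/-- The room `ρ_x = 1 − log x/L` of the state `x` (`L = log M`). -/
def room (L : ℝ) (x : ℕ) : ℝ := 1 - Real.log x / L

/-- `Π(u;x) = ∏_{p ∣ x} (1 − e^{−u·log p/L})` — one factor per DISTINCT prime divisor. -/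
def primeProd (L u : ℝ) (x : ℕ) : ℝ := ∏ p ∈ x.primeFactors, (1 - Real.exp (-(u * (Real.log p / L))))

/-- `W(x) = ∏_{p ∣ x} p/(p−1)` — the grand-canonical weight of CONTINUUM-LIMIT 16.2. -/
def wProd (x : ℕ) : ℝ := ∏ p ∈ x.primeFactors, ((p : ℝ) / ((p : ℝ) - 1))

/-- The state `1` has full room. -/
theorem room_one (L : ℝ) : room L 1 = 1 := by simp [room]

/-- `Π(u;1) = 1`. -/
theorem primeProd_one (L u : ℝ) : primeProd L u 1 = 1 := by simp [primeProd]

/-- `W(1) = 1`. -/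
theorem wProd_one : wProd 1 = 1 := by simp [wProd]

/-! ## The room under multiplication / division -/

/-- Birth `x → xn`: the room shrinks by `log n/L`. -/
theorem room_mul (L : ℝ) {x n : ℕ} (hx : x ≠ 0) (hn : n ≠ 0) :
    room L (x * n) = room L x - Real.log n / L := by
  unfold room
  rw [Nat.cast_mul, Real.log_mul (Nat.cast_ne_zero.2 hx) (Nat.cast_ne_zero.2 hn)]
  ring

/-- Death `x → x/n` (`n ∣ x`): the room grows by `log n/L`. -/
theorem room_div (L : ℝ) {x n : ℕ} (hx : x ≠ 0) (hn : n ∣ x) :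
    room L (x / n) = room L x + Real.log n / L := by
  have hn0 : n ≠ 0 := by rintro rfl; simp at hn; exact hx hn
  unfold room
  rw [Nat.cast_div hn (Nat.cast_ne_zero.2 hn0),
    Real.log_div (Nat.cast_ne_zero.2 hx) (Nat.cast_ne_zero.2 hn0)]
  ring

/-- In `θ`-units: `room L (x·p^a) = room L x − a·(log p/L)`. -/
theorem room_mul_prime_pow (L : ℝ) {x p : ℕ} (hx : x ≠ 0) (hp : p ≠ 0) (a : ℕ) :
    room L (x * p ^ a) = room L x - a * (Real.log p / L) := by
  rw [room_mul L hx (pow_ne_zero a hp), Nat.cast_pow, Real.log_pow]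
  ring

/-- In `θ`-units: `room L (x/p^b) = room L x + b·(log p/L)` when `p^b ∣ x`. -/
theorem room_div_prime_pow (L : ℝ) {x p b : ℕ} (hx : x ≠ 0) (h : p ^ b ∣ x) :
    room L (x / p ^ b) = room L x + b * (Real.log p / L) := by
  rw [room_div L hx h, Nat.cast_pow, Real.log_pow]
  ring

/-! ## The prime set under the five move types -/

/-- NEW prime: `q ∤ x`, `a ≥ 1` ⇒ `primeFactors (x·q^a) = insert q (primeFactors x)` and `q ∉ primeFactors x`. -/
theorem primeFactors_mul_prime_pow_of_not_dvd {x q a : ℕ} (hx : x ≠ 0) (hq : q.Prime) (ha : a ≠ 0) :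
    (x * q ^ a).primeFactors = insert q x.primeFactors := by
  rw [Nat.primeFactors_mul hx (pow_ne_zero a hq.ne_zero), Nat.primeFactors_pow _ ha, hq.primeFactors,
    Finset.union_comm]
  rfl

/-- A prime not dividing `x` is not among its prime factors. -/
theorem not_mem_primeFactors_of_not_dvd {x q : ℕ} (hqx : ¬ q ∣ x) : q ∉ x.primeFactors := fun h =>
  hqx (Nat.dvd_of_mem_primeFactors h)

/-- PRESENT prime: `p ∣ x` ⇒ `primeFactors (x·p^a) = primeFactors x`. -/
theorem primeFactors_mul_pow_of_dvd {x p : ℕ} (hx : x ≠ 0) (hp : p.Prime) (hpx : p ∣ x) (a : ℕ) :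
    (x * p ^ a).primeFactors = x.primeFactors := by
  rcases Nat.eq_zero_or_pos a with rfl | ha
  · simp
  · rw [Nat.primeFactors_mul hx (pow_ne_zero a hp.ne_zero), Nat.primeFactors_pow _ ha.ne', hp.primeFactors]
    exact Finset.union_eq_left.2 (Finset.singleton_subset_iff.2 (Nat.mem_primeFactors.2 ⟨hp, hpx, hx⟩))

/-- PARTIAL death: `b < v_p(x)` ⇒ `primeFactors (x/p^b) = primeFactors x`. -/
theorem primeFactors_div_pow_of_lt {x p b : ℕ} (hx : x ≠ 0) (hp : p.Prime) (hb : b < x.factorization p) :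
    (x / p ^ b).primeFactors = x.primeFactors := by
  have hdvd : p ^ b ∣ x := (hp.pow_dvd_iff_le_factorization hx).2 hb.le
  have hdvd' : p ^ (b + 1) ∣ x := (hp.pow_dvd_iff_le_factorization hx).2 hb
  obtain ⟨y, hy⟩ := hdvd
  have hy0 : y ≠ 0 := by rintro rfl; simp at hy; exact hx hy
  have hpy : p ∣ y := by
    rw [hy, pow_succ] at hdvd'
    exact (Nat.mul_dvd_mul_iff_left (pow_pos hp.pos b)).1 hdvd'
  rw [hy, Nat.mul_div_cancel_left y (pow_pos hp.pos b), mul_comm, primeFactors_mul_pow_of_dvd hy0 hp hpy]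

/-- FULL death: `primeFactors (x / p^{v_p(x)}) = (primeFactors x).erase p` (`p ∣ x`). -/
theorem primeFactors_ordCompl {x p : ℕ} (hx : x ≠ 0) (hp : p.Prime) :
    (x / p ^ x.factorization p).primeFactors = x.primeFactors.erase p := by
  have hnd : ¬ p ∣ x / p ^ x.factorization p := Nat.not_dvd_ordCompl hp hx
  have hsplit : x = (x / p ^ x.factorization p) * p ^ x.factorization p := by
    rw [mul_comm]; exact (Nat.ordProj_mul_ordCompl_eq_self x p).symm
  have hy0 : x / p ^ x.factorization p ≠ 0 := by
    intro h; rw [h, zero_mul] at hsplit; exact hx hsplit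
  rcases Nat.eq_zero_or_pos (x.factorization p) with h0 | hpos
  · -- p ∤ x: nothing to erase
    have hpx : ¬ p ∣ x := by
      intro h
      have := (hp.pow_dvd_iff_le_factorization hx).1 (by simpa using h : p ^ 1 ∣ x)
      omega
    rw [h0, pow_zero, Nat.div_one, Finset.erase_eq_of_notMem (not_mem_primeFactors_of_not_dvd hpx)]
  · conv_rhs => rw [hsplit, primeFactors_mul_prime_pow_of_not_dvd hy0 hp hpos.ne']
    rw [Finset.erase_insert (not_mem_primeFactors_of_not_dvd hnd)]

/-! ## Consequences for `Π` and `W` -/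

/-- NEW prime birth: `Π(u; x·q^a) = Π(u;x)·(1 − e^{−uθ_q})`. -/
theorem primeProd_mul_of_not_dvd (L u : ℝ) {x q a : ℕ} (hx : x ≠ 0) (hq : q.Prime) (hqx : ¬ q ∣ x)
    (ha : a ≠ 0) :
    primeProd L u (x * q ^ a) = primeProd L u x * (1 - Real.exp (-(u * (Real.log q / L)))) := by
  unfold primeProd
  rw [primeFactors_mul_prime_pow_of_not_dvd hx hq ha, Finset.prod_insert (not_mem_primeFactors_of_not_dvd hqx),
    mul_comm]

/-- NEW prime birth: `W(x·q^a) = W(x)·q/(q−1)`. -/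
theorem wProd_mul_of_not_dvd {x q a : ℕ} (hx : x ≠ 0) (hq : q.Prime) (hqx : ¬ q ∣ x) (ha : a ≠ 0) :
    wProd (x * q ^ a) = wProd x * ((q : ℝ) / ((q : ℝ) - 1)) := by
  unfold wProd
  rw [primeFactors_mul_prime_pow_of_not_dvd hx hq ha, Finset.prod_insert (not_mem_primeFactors_of_not_dvd hqx),
    mul_comm]

/-- PRESENT prime birth: `Π` and `W` unchanged. -/
theorem primeProd_mul_of_dvd (L u : ℝ) {x p : ℕ} (hx : x ≠ 0) (hp : p.Prime) (hpx : p ∣ x) (a : ℕ) :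
    primeProd L u (x * p ^ a) = primeProd L u x := by
  unfold primeProd; rw [primeFactors_mul_pow_of_dvd hx hp hpx a]

/-- PRESENT prime birth: `W` unchanged. -/
theorem wProd_mul_of_dvd {x p : ℕ} (hx : x ≠ 0) (hp : p.Prime) (hpx : p ∣ x) (a : ℕ) :
    wProd (x * p ^ a) = wProd x := by
  unfold wProd; rw [primeFactors_mul_pow_of_dvd hx hp hpx a]

/-- PARTIAL death: `Π` and `W` unchanged. -/
theorem primeProd_div_of_lt (L u : ℝ) {x p b : ℕ} (hx : x ≠ 0) (hp : p.Prime) (hb : b < x.factorization p) :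
    primeProd L u (x / p ^ b) = primeProd L u x := by
  unfold primeProd; rw [primeFactors_div_pow_of_lt hx hp hb]

/-- PARTIAL death: `W` unchanged. -/
theorem wProd_div_of_lt {x p b : ℕ} (hx : x ≠ 0) (hp : p.Prime) (hb : b < x.factorization p) :
    wProd (x / p ^ b) = wProd x := by
  unfold wProd; rw [primeFactors_div_pow_of_lt hx hp hb]

/-- FULL death: `Π(u;x) = Π(u; x/p^{v_p(x)})·(1 − e^{−uθ_p})` for `p ∣ x`. -/
theorem primeProd_eq_ordCompl_mul (L u : ℝ) {x p : ℕ} (hx : x ≠ 0) (hp : p.Prime) (hpx : p ∣ x) :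
    primeProd L u x = primeProd L u (x / p ^ x.factorization p) * (1 - Real.exp (-(u * (Real.log p / L)))) := by
  unfold primeProd
  rw [primeFactors_ordCompl hx hp, mul_comm,
    ← Finset.mul_prod_erase _ _ (Nat.mem_primeFactors.2 ⟨hp, hpx, hx⟩)]

/-- FULL death: `W(x) = W(x/p^{v_p(x)})·p/(p−1)` for `p ∣ x`. -/
theorem wProd_eq_ordCompl_mul {x p : ℕ} (hx : x ≠ 0) (hp : p.Prime) (hpx : p ∣ x) :
    wProd x = wProd (x / p ^ x.factorization p) * ((p : ℝ) / ((p : ℝ) - 1)) := by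
  unfold wProd
  rw [primeFactors_ordCompl hx hp, mul_comm,
    ← Finset.mul_prod_erase _ _ (Nat.mem_primeFactors.2 ⟨hp, hpx, hx⟩)]

/-- `W(x) ≥ 1` (each factor `p/(p−1) ≥ 1`). -/
theorem one_le_wProd (x : ℕ) : 1 ≤ wProd x := by
  unfold wProd
  calc (1 : ℝ) = ∏ p ∈ x.primeFactors, (1 : ℝ) := by simp
    _ ≤ ∏ p ∈ x.primeFactors, ((p : ℝ) / ((p : ℝ) - 1)) := by
      refine Finset.prod_le_prod (fun _ _ => zero_le_one) fun p hp => ?_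
      have hp2 : (2 : ℝ) ≤ p := by exact_mod_cast (Nat.prime_of_mem_primeFactors hp).two_le
      rw [le_div_iff₀ (by linarith)]
      linarith

/-- `Π(u;x) ≥ 0` for `u ≥ 0`, `L ≥ 0`. -/
theorem primeProd_nonneg {L u : ℝ} (hL : 0 ≤ L) (hu : 0 ≤ u) (x : ℕ) : 0 ≤ primeProd L u x := by
  unfold primeProd
  refine Finset.prod_nonneg fun p _ => ?_
  rw [sub_nonneg, Real.exp_le_one_iff, neg_nonpos]
  exact mul_nonneg hu (div_nonneg (Real.log_natCast_nonneg p) hL)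

end Summit.RiemannHypothesis.RiemannHypothesis.Theorems.IntegerScrew

end
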